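import Summits.CriticalPhenomena.Ising3DConformalLimit.Theses.SubPtolemyInterlacing
import Summits.CriticalPhenomena.Ising3DConformalLimit.Theses.PerfectScreening
import Literature.Probability.LatticeModels.HighDimPointwiseTriviality
import Literature.Probability.LatticeModels.ImprovedTreeDiagramBoundProofs
import Literature.Probability.LatticeModels.PointwiseScalingLimitEtaExists

/-!
# Disproof of `SubPtolemyFloor` (stmt-CriticalPhenomena-15703) — findings

Crux (route SubPtolemyInterlacing, r3), verbatim:
`∃ a c : ℝ, a < Real.logb 2 (1 + √2) ∧ 0 < c ∧ ∀ n : ℕ, 1 ≤ n →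
   c * (n:ℝ) ^ (-a) ≤ criticalTwoPoint 3 ((n:ℤ) • (Pi.single 0 1 : Site 3))`
— an axial power floor `⟨σ₀σ_{n e₁}⟩⁺_{β_c(3)} ≥ c·n^{-a}` with exponent below the Ptolemy-balanced
Gaussian threshold `log₂(1+√2) = 1.27155…`, i.e. one-sided `η(3) < 0.2716` (truth `2Δ_σ = 1.0363`).

**VERDICT (cdisprove, cycle 1): NOT REFUTED — and immune to an unconditional kill with present
knowledge.** Typing is faithful (§0: `rpow` at `n ≥ 1` only, no `0^x` junk; `n • e₁ = Pi.single 0 n`;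
`1 < 5/4 < log₂(1+√2) < 3/2 < 2` proved). The statement is an honest open problem sitting strictly
inside the rigorous window: every witness has `1 ≤ a` (infrared bound, §1) and the weakening to any
threshold `T > 2` is a theorem (Simon–Lieb, §1), while NO exponent `< 2` is unconditionally in print
(Duminil-Copin–Panis 2025 give `η ≤ 1/2` only if `η` exists — and `3/2 > log₂(1+√2)` anyway, §0).
A refutation `¬r3` would PROVE the open item stmt-CriticalPhenomena-1342 (`PerfectScreening.NonSaturation`,
weak `η(3) > 0`; §2), and — granted any non-degenerate pointwise scaling limit, in particular the route's
own crux `MoebiusLimit` — `r3 ↔ 2Δ < log₂(1+√2)` EXACTLY (§3), so a kill is the assertion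
`Δ_σ(3) ≥ 0.6358` against the bootstrap/MC value `Δ_σ = 0.5181489(10)` (inside the tree's rigorous window
`Δ ∈ [1/2, 3/4]`, `exists_rpow_scale_mem_Icc_threeQuarters`). Nothing rigorous points that way.

## Index (all theorems sorry-free; `lean check` rc 0)
* §0 TYPING / MUTATION: `crux_iff_single`, `one_lt_threshold`, `five_fourths_lt_threshold`,
  `threshold_lt_three_halves`, `threshold_lt_two`; `crux_iff_eventually` (**`c` and `n ≥ 1` are cosmetic:
  r3 ↔ ∃ a < log₂(1+√2), eventually `n^{-a} ≤ G(ne₁)`** — only the tail exponent is load-bearing).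
* §1 EXPONENT WINDOW (landed as `Theorems/SubPtolemyFloor/Negative/ExponentWindow.lean`, p128798):
  `exponent_ge_dim_sub_two` (IR: `d - 2 ≤ a` on `ℤ^d`), `exponent_ge_one`, `crux_iff_window`
  (`r3 ↔` the same with `1 ≤ a`), `not_floor_of_threshold_le_one` (strengthening `T ≤ 1` FALSE),
  `floor_of_two_lt_threshold` (weakening `T > 2` a THEOREM), `floorAt_false_of_four_le` (the `ℤ^d`,
  `d ≥ 4` analogue is FALSE: `d = 3` is load-bearing; no dimension-uniform proof).
* §2 WHAT A REFUTATION COSTS: `crux_of_irSaturation`, `crux_of_coulomb` (IR-saturation / the Coulomb law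
  prove r3 with `a = 1`), `nonSaturation_of_not_crux` (**`¬r3 → PerfectScreening.NonSaturation`** =
  item 1342, open), `crux_or_nonSaturation`.
* §3 CONDITIONAL CHARACTERISATION: `exponent_le_of_floor` (abstract: a floor with exponent `a` forces the
  log-exponent `L ≤ a`), `crux_iff_of_hasDecayExponent` (**if the axial exponent `L` exists, `r3 ↔ L <
  log₂(1+√2)`**), `crux_iff_of_limit` / `crux_iff_of_scaleCovariant_limit` (**given a non-degenerate
  pointwise limit with dimension `Δ`: `r3 ↔ 2Δ < log₂(1+√2)`**), `exists_dim_crux_iff_of_limit`,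
  `crux_iff_of_moebiusLimit` (under the route's ML crux), `not_crux_iff_of_limit` (the kill = `Δ ≥ 0.6358`).
* §4 THRESHOLD TIGHTNESS: `rpow_neg_threshold` (`2^{-log₂(1+√2)} = √2-1`), `balancedTest_neg_iff`
  (`1 - 2u - u² < 0 ↔ t < log₂(1+√2)`, `u = 2^{-t}`), `balancedTest_eq_zero_at_threshold`,
  `balancedTest_nonneg_of_threshold_le`: the route's sign test at `x⋆ = (0,2,3,6)e₁` dies exactly at the
  crux's threshold — `a < log₂(1+√2)` cannot be relaxed to `≤` or to any larger constant.
* §5 TWO-POINT AXIOMATICS DO NOT DECIDE r3: the profile `p(n) = n^{-3/2}` obeys every axial two-point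
  constraint the tree knows at `β_c(3)` — `n^{-2} ≤ p ≤ n^{-1}` (Simon–Lieb / IR), monotone, exponent
  `3/2 ≤ 3/2` (DCP 2025 Thm 1.5 window), DCP Thm 1.3 shape up to constants (`χ_{4n} ≍ n^{3/2}`,
  `n Σ_{k≤2n} k p(k) ≍ n^{3/2}`; `‖x‖_∞^{-3/2}` is moreover completely monotone / RP-compatible) — yet
  `not_floor_modelProfile`: it violates the floor. Any proof must use more than two-point axiomatics
  (both crux ideas, `volume-threshold-split` and `lee-yang-tail-transfer`, already concede this).
* §6 WHY IT RESISTS (this docblock) · `-- Targets`: none yet (no line picked; `stuck_stubs = []`).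

## Why it resists (for ideators / the lead)
1. Monotone in the data: r3 only gets easier as `G` grows; a counterexample must be an UPPER bound
   `G(n_j e₁) ≤ n_j^{-a}` along a sequence, for EVERY `a < 1.2716` — i.e. `η(3) ≥ 0.2716` one-sidedly.
   Best rigorous upper bound: the infrared `C/n` (`a = 1`); no `ε`-gain over FSS at `β_c(3)` exists in
   print (this is item 1342's own why-might-fail). Numerics: `η = 0.0362978(20)` (bootstrap, KPSV 2016),
   `0.03627(10)` (MC) — a factor 7.5 below the kill line.
2. Small/finite models are powerless: the statement is about the infinite-volume critical point; finite
   boxes, `β ≠ β_c`, `d ≠ 3` are different statements (`d ≥ 4`: false, §1; `d = 2`: true with `a = 1/4`).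
3. Known counterexample FAMILIES live elsewhere: reflection-positive long-range Ising on `ℤ³` with
   coupling `|x|^{-(3+α)}`, `α < 3 - log₂(1+√2) ≈ 1.728`, has `2Δ = 3 - α > 1.2716` (Gaussian for
   `α ≤ 3/2`, Lohmann–Slade–Wallace 2017; interacting for `3/2 < α < 1.728`) — so any proof must use the
   nearest-neighbour (finite-range) structure; but these are not the model of the crux.
4. Conditional landscape (§3): with ANY non-degenerate pointwise limit, r3 is the single number
   `Δ < 0.6358`; the tree confines `Δ` to `[0.5, 0.75]`; DCP's reflected currents give the upper end.
   A disproof must therefore either (a) build a limit with `Δ ≥ 0.6358` — contradicting all numerics — or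
   (b) prove `limsup -log G(ne₁)/log n ≥ 1.2716` without a limit, which in particular proves item 1342.

## Attacks run this cycle (all fail to bite; recorded so nobody repeats them)
* vacuity/triviality: `simp/decide/norm_num/positivity/aesop` do not close r3 or `¬r3` (opaque
  `criticalTwoPoint`); hypotheses-free `∃`, not vacuous (window non-empty: `one_lt_threshold`).
* degenerate parameters: `n = 0` excluded by `1 ≤ n`; `a ≤ 0` impossible (G → 0... and `a ≥ 1` anyway);
  `c ≥ 1` impossible (`c ≤ G(e₁) < 1`) — harmless, `c` is existential.
* dimension shift: `d ≥ 4` refuted (§1) — confirms `d = 3` load-bearing, not a refutation of r3.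
* threshold shift: `T ≤ 1` refuted, `T > 2` proved (§1); r3 sits at `T = 1.2716 ∈ (1, 2]`, open.
* barrier catalogue: IsingTrivialityFromDimensionFour / LongRangeTrivialityOnZ3 bite only
  dimension-uniform or range-uniform PROOFS (consistent with §1, item 3 above), not the statement.
* literature negatives: `ledger negatives --problem CriticalPhenomena` — none on Ising₃ two-point decay.
-/

noncomputable section

namespace Summit.CriticalPhenomena.Ising3DConformalLimit.Cruxes.SubPtolemyFloor.Disproof

open Literature.Probability.LatticeModels Filter Set
open Summit.CriticalPhenomena.Ising3DConformalLimit.Theses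
open Summit.CriticalPhenomena.Ising3DConformalLimit.Theses.SubPtolemyInterlacing
open scoped Topology

/-! ## §0 Typing audit: the statement read back, and the threshold as a number -/

/-- r3 with `n • e₁` rewritten as `Pi.single 0 n` (the form of the tree's axis lemmas). [folklore] -/
theorem crux_iff_single :
    SubPtolemyFloor ↔ ∃ a c : ℝ, a < Real.logb 2 (1 + Real.sqrt 2) ∧ 0 < c ∧ ∀ n : ℕ, 1 ≤ n →
      c * (n : ℝ) ^ (-a) ≤ criticalTwoPoint 3 (Pi.single 0 (n : ℤ)) := by
  unfold SubPtolemyFloor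
  simp only [zsmul_single_zero_one]

/-- `1 < log₂(1+√2)` (`2 < 1 + √2`). [folklore] -/
theorem one_lt_threshold : (1 : ℝ) < Real.logb 2 (1 + Real.sqrt 2) := by
  rw [Real.lt_logb_iff_rpow_lt one_lt_two (by positivity), Real.rpow_one]
  have h : (1 : ℝ) < Real.sqrt 2 := by
    rw [Real.lt_sqrt zero_le_one]; norm_num
  linarith

/-- `5/4 < log₂(1+√2)` (`2^5 = 32 < (1+√2)^4 = 17 + 12√2`): a floor with `a = 5/4`, i.e. one-sided
`η(3) < 1/4 = η(2)`, would already give r3. [folklore] -/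
theorem five_fourths_lt_threshold : (5 / 4 : ℝ) < Real.logb 2 (1 + Real.sqrt 2) := by
  rw [Real.lt_logb_iff_rpow_lt one_lt_two (by positivity)]
  have hs : Real.sqrt 2 ^ 2 = 2 := Real.sq_sqrt (by norm_num)
  have hs0 : 0 ≤ Real.sqrt 2 := Real.sqrt_nonneg 2
  have h54 : (5 / 4 : ℝ) < Real.sqrt 2 := by
    rw [Real.lt_sqrt (by norm_num)]; norm_num
  have hpow : ((2 : ℝ) ^ ((5 : ℝ) / 4)) ^ (4 : ℕ) = 32 := by
    rw [← Real.rpow_mul_natCast (by norm_num)]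
    norm_num
  have h4 : (32 : ℝ) < (1 + Real.sqrt 2) ^ (4 : ℕ) := by
    have hs4 : Real.sqrt 2 ^ 4 = 4 := by nlinarith [hs]
    have hs3 : Real.sqrt 2 ^ 3 = 2 * Real.sqrt 2 := by nlinarith [hs]
    nlinarith [hs, hs3, hs4, h54]
  refine lt_of_pow_lt_pow_left₀ 4 (by positivity) ?_
  rw [hpow]
  exact h4

/-- `log₂(1+√2) < 3/2` (`1 + √2 < 2√2`): even the CONDITIONAL Duminil-Copin–Panis window `2Δ ≤ 3/2`
(`dcp_isingEta_le_half_holds`) contains exponents violating the floor. [folklore] -/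
theorem threshold_lt_three_halves : Real.logb 2 (1 + Real.sqrt 2) < 3 / 2 := by
  rw [Real.logb_lt_iff_lt_rpow one_lt_two (by positivity)]
  have h2 : (2 : ℝ) ^ ((3 : ℝ) / 2) = 2 * Real.sqrt 2 := by
    rw [show ((3 : ℝ) / 2) = 1 + 1 / 2 by norm_num, Real.rpow_add two_pos, Real.rpow_one,
      Real.sqrt_eq_rpow]
  rw [h2]
  have h : (1 : ℝ) < Real.sqrt 2 := by
    rw [Real.lt_sqrt zero_le_one]; norm_num
  linarith

/-- `log₂(1+√2) < 2` (`1 + √2 < 4`). [folklore] -/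
theorem threshold_lt_two : Real.logb 2 (1 + Real.sqrt 2) < 2 := by
  linarith [threshold_lt_three_halves]

/-- **Hypothesis mutation: `c` and the range `n ≥ 1` are cosmetic, only the TAIL EXPONENT is load-bearing**:
r3 ↔ `∃ a < log₂(1+√2), ∀ᶠ n, n^{-a} ≤ ⟨σ₀σ_{n e₁}⟩_{β_c(3)}`. (`→`: any slightly larger exponent absorbs the
constant; `←`: `a ↦ max a 0`, then axial monotonicity (Messager–Miracle-Solé) and positivity fill the small
`n` with `c = G(N e₁) ≤ 1`.) [cite: MessagerMiracleSoleJSP1977, main theorem (monotonicity of ⟨σ₀σ_x⟩ under reflections)] -/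
theorem crux_iff_eventually :
    SubPtolemyFloor ↔ ∃ a : ℝ, a < Real.logb 2 (1 + Real.sqrt 2) ∧
      ∀ᶠ n : ℕ in atTop, (n : ℝ) ^ (-a) ≤ criticalTwoPoint 3 (Pi.single 0 (n : ℤ)) := by
  rw [crux_iff_single]
  constructor
  · rintro ⟨a, c, ha, hc, h⟩
    set a' : ℝ := (a + Real.logb 2 (1 + Real.sqrt 2)) / 2 with ha'
    refine ⟨a', by linarith, ?_⟩
    have hpos : 0 < a' - a := by rw [ha']; linarith
    have ht : Tendsto (fun n : ℕ => c * (n : ℝ) ^ (a' - a)) atTop atTop :=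
      Tendsto.const_mul_atTop hc ((tendsto_rpow_atTop hpos).comp tendsto_natCast_atTop_atTop)
    filter_upwards [ht.eventually_ge_atTop 1, eventually_ge_atTop 1] with n hn1 hn
    have hn0 : (0 : ℝ) < n := by exact_mod_cast hn
    calc (n : ℝ) ^ (-a') = (n : ℝ) ^ (-a') * 1 := (mul_one _).symm
      _ ≤ (n : ℝ) ^ (-a') * (c * (n : ℝ) ^ (a' - a)) :=
          mul_le_mul_of_nonneg_left hn1 (Real.rpow_nonneg hn0.le _)
      _ = c * (n : ℝ) ^ (-a) := by
          rw [mul_comm, mul_assoc, ← Real.rpow_add hn0, show a' - a + -a' = -a by ring]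
      _ ≤ criticalTwoPoint 3 (Pi.single 0 (n : ℤ)) := h n hn
  · rintro ⟨a, ha, hev⟩
    obtain ⟨N, hN⟩ := eventually_atTop.1 (hev.and (eventually_ge_atTop 1))
    set b : ℝ := max a 0 with hb
    have hbT : b < Real.logb 2 (1 + Real.sqrt 2) := max_lt ha (by linarith [one_lt_threshold])
    refine ⟨b, criticalTwoPoint 3 (Pi.single 0 (N : ℤ)), hbT, criticalTwoPoint_axis_pos N,
      fun n hn => ?_⟩
    have hn0 : (0 : ℝ) < n := by exact_mod_cast hn
    have h1n : (1 : ℝ) ≤ n := by exact_mod_cast hn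
    have hgN1 : criticalTwoPoint 3 (Pi.single 0 (N : ℤ)) ≤ 1 := criticalTwoPoint_le_one' _
    have hgN0 : 0 ≤ criticalTwoPoint 3 (Pi.single 0 (N : ℤ)) := (criticalTwoPoint_axis_pos N).le
    have hba : (n : ℝ) ^ (-b) ≤ (n : ℝ) ^ (-a) :=
      Real.rpow_le_rpow_of_exponent_le h1n (neg_le_neg (le_max_left a 0))
    have hpow1 : (n : ℝ) ^ (-b) ≤ 1 :=
      Real.rpow_le_one_of_one_le_of_nonpos h1n (neg_nonpos.2 (le_max_right a 0))
    have hpow0 : 0 ≤ (n : ℝ) ^ (-b) := Real.rpow_nonneg hn0.le _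
    rcases le_or_gt N n with hle | hlt
    · calc criticalTwoPoint 3 (Pi.single 0 (N : ℤ)) * (n : ℝ) ^ (-b)
          ≤ 1 * (n : ℝ) ^ (-b) := mul_le_mul_of_nonneg_right hgN1 hpow0
        _ = (n : ℝ) ^ (-b) := one_mul _
        _ ≤ (n : ℝ) ^ (-a) := hba
        _ ≤ criticalTwoPoint 3 (Pi.single 0 (n : ℤ)) := (hN n hle).1
    · calc criticalTwoPoint 3 (Pi.single 0 (N : ℤ)) * (n : ℝ) ^ (-b)
          ≤ criticalTwoPoint 3 (Pi.single 0 (N : ℤ)) * 1 := mul_le_mul_of_nonneg_left hpow1 hgN0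
        _ = criticalTwoPoint 3 (Pi.single 0 (N : ℤ)) := mul_one _
        _ ≤ criticalTwoPoint 3 (Pi.single 0 (n : ℤ)) := criticalTwoPoint_axis_antitone hlt.le

/-! ## §1 Exponent window (landed: `Theorems/SubPtolemyFloor/Negative/ExponentWindow.lean`) -/

/-- `n • e₁ ≠ 0` for `n ≥ 1`. [folklore] -/
theorem axis_ne_zero {d : ℕ} [NeZero d] {n : ℕ} (hn : 1 ≤ n) :
    ((n : ℤ) • (Pi.single 0 1 : Site d)) ≠ 0 := by
  rw [zsmul_single_zero_one]
  intro h0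
  have := congr_fun h0 (0 : Fin d)
  simp at this
  omega

/-- `‖n • e₁‖_∞ = n`. [folklore] -/
theorem supNorm_axis {d : ℕ} [NeZero d] (n : ℕ) :
    Site.supNorm ((n : ℤ) • (Pi.single 0 1 : Site d)) = n := by
  rw [zsmul_single_zero_one, Site.supNorm_single]
  simp

/-- **Any axial power floor has exponent `a ≥ d - 2`** (`d ≥ 3`; infrared bound
`⟨σ₀σ_v⟩_{β_c} ≤ C‖v‖_∞^{-(d-2)}`, tree theorem `exists_criticalTwoPoint_le_inv_pow`). [cite: DuminilCopin2019, Thm. 4.8, §4.4] -/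
theorem exponent_ge_dim_sub_two {d : ℕ} [NeZero d] (hd : 3 ≤ d) {a c : ℝ} (hc : 0 < c)
    (h : ∀ n : ℕ, 1 ≤ n →
      c * (n : ℝ) ^ (-a) ≤ criticalTwoPoint d ((n : ℤ) • (Pi.single 0 1 : Site d))) :
    (d : ℝ) - 2 ≤ a := by
  by_contra hlt
  rw [not_le] at hlt
  obtain ⟨C, -, hC⟩ := exists_criticalTwoPoint_le_inv_pow hd
  have hpowcast : ∀ n : ℕ, 1 ≤ n → ((n : ℝ) ^ (d - 2 : ℕ)) = (n : ℝ) ^ ((d : ℝ) - 2) := by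
    intro n _
    rw [← Real.rpow_natCast]
    congr 1
    rw [Nat.cast_sub (by omega : 2 ≤ d)]
    norm_num
  have key : ∀ n : ℕ, 1 ≤ n → c * (n : ℝ) ^ ((d : ℝ) - 2 - a) ≤ C := by
    intro n hn
    have hn0 : (0 : ℝ) < n := by exact_mod_cast hn
    have h2 := hC _ (axis_ne_zero hn)
    rw [supNorm_axis] at h2
    have h3 : c * (n : ℝ) ^ (-a) ≤ C * ((n : ℝ) ^ (d - 2 : ℕ))⁻¹ := (h n hn).trans h2
    have h4 : c * (n : ℝ) ^ (-a) * (n : ℝ) ^ ((d : ℝ) - 2) ≤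
        C * ((n : ℝ) ^ (d - 2 : ℕ))⁻¹ * (n : ℝ) ^ ((d : ℝ) - 2) :=
      mul_le_mul_of_nonneg_right h3 (Real.rpow_nonneg hn0.le _)
    calc c * (n : ℝ) ^ ((d : ℝ) - 2 - a)
        = c * (n : ℝ) ^ (-a) * (n : ℝ) ^ ((d : ℝ) - 2) := by
          rw [show ((d : ℝ) - 2 - a) = -a + ((d : ℝ) - 2) by ring, Real.rpow_add hn0, mul_assoc]
      _ ≤ C * ((n : ℝ) ^ (d - 2 : ℕ))⁻¹ * (n : ℝ) ^ ((d : ℝ) - 2) := h4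
      _ = C := by
          rw [← hpowcast n hn, mul_assoc, inv_mul_cancel₀ (pow_ne_zero _ hn0.ne'), mul_one]
  have hpos : 0 < (d : ℝ) - 2 - a := by linarith
  have ht : Tendsto (fun n : ℕ => c * (n : ℝ) ^ ((d : ℝ) - 2 - a)) atTop atTop :=
    Tendsto.const_mul_atTop hc ((tendsto_rpow_atTop hpos).comp tendsto_natCast_atTop_atTop)
  obtain ⟨n, hnC, hn1⟩ := ((ht.eventually_gt_atTop C).and (eventually_ge_atTop 1)).exists
  exact absurd (key n hn1) (not_le.2 hnC)

/-- **On `ℤ³` every witness of r3 has `a ≥ 1`.** [cite: DuminilCopin2019, Thm. 4.8, §4.4] -/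
theorem exponent_ge_one {a c : ℝ} (hc : 0 < c)
    (h : ∀ n : ℕ, 1 ≤ n →
      c * (n : ℝ) ^ (-a) ≤ criticalTwoPoint 3 ((n : ℤ) • (Pi.single 0 1 : Site 3))) :
    1 ≤ a := by
  have := exponent_ge_dim_sub_two (d := 3) le_rfl hc h
  norm_num at this
  exact this

/-- **r3 is equivalent to its windowed form** (`1 ≤ a < log₂(1+√2)`). [folklore] -/
theorem crux_iff_window :
    SubPtolemyFloor ↔
      ∃ a c : ℝ, 1 ≤ a ∧ a < Real.logb 2 (1 + Real.sqrt 2) ∧ 0 < c ∧ ∀ n : ℕ, 1 ≤ n →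
        c * (n : ℝ) ^ (-a) ≤ criticalTwoPoint 3 ((n : ℤ) • (Pi.single 0 1 : Site 3)) := by
  constructor
  · rintro ⟨a, c, ha, hc, h⟩
    exact ⟨a, c, exponent_ge_one hc h, ha, hc, h⟩
  · rintro ⟨a, c, -, ha, hc, h⟩
    exact ⟨a, c, ha, hc, h⟩

/-- **Strengthening refuted**: threshold `T ≤ 1` makes the floor FALSE. [cite: DuminilCopin2019, Thm. 4.8, §4.4] -/
theorem not_floor_of_threshold_le_one {T : ℝ} (hT : T ≤ 1) :
    ¬ ∃ a c : ℝ, a < T ∧ 0 < c ∧ ∀ n : ℕ, 1 ≤ n →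
        c * (n : ℝ) ^ (-a) ≤ criticalTwoPoint 3 ((n : ℤ) • (Pi.single 0 1 : Site 3)) := by
  rintro ⟨a, c, ha, hc, h⟩
  have := exponent_ge_one hc h
  linarith

/-- **Weakening is a theorem**: threshold `T > 2` makes the floor TRUE (Simon–Lieb `c‖x‖_∞^{-2} ≤ G`,
tree theorem `criticalTwoPoint_bounds_holds`). [cite: DuminilCopin2019, Thm. 4.8, §4.4] -/
theorem floor_of_two_lt_threshold {T : ℝ} (hT : 2 < T) :
    ∃ a c : ℝ, a < T ∧ 0 < c ∧ ∀ n : ℕ, 1 ≤ n →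
        c * (n : ℝ) ^ (-a) ≤ criticalTwoPoint 3 ((n : ℤ) • (Pi.single 0 1 : Site 3)) := by
  obtain ⟨c, C, hc, h⟩ := criticalTwoPoint_bounds_holds (d := 3) le_rfl
  refine ⟨2, c, hT, hc, fun n hn => ?_⟩
  have h1 := (h _ (axis_ne_zero hn)).1
  rw [Site.norm_eq_supNorm, supNorm_axis] at h1
  have e : (-(((3 : ℕ) : ℝ) - 1)) = -2 := by norm_num
  rw [e] at h1
  exact h1

/-- **The `ℤ^d`, `d ≥ 4` form of r3 is FALSE** (`a ≥ d - 2 ≥ 2 > log₂(1+√2)`): `d = 3` is load-bearing. [cite: DuminilCopin2019, Thm. 4.8, §4.4] -/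
theorem floorAt_false_of_four_le {d : ℕ} [NeZero d] (hd : 4 ≤ d) :
    ¬ ∃ a c : ℝ, a < Real.logb 2 (1 + Real.sqrt 2) ∧ 0 < c ∧ ∀ n : ℕ, 1 ≤ n →
        c * (n : ℝ) ^ (-a) ≤ criticalTwoPoint d ((n : ℤ) • (Pi.single 0 1 : Site d)) := by
  rintro ⟨a, c, ha, hc, h⟩
  have h1 := exponent_ge_dim_sub_two (by omega) hc h
  have h4 : (4 : ℝ) ≤ d := by exact_mod_cast hd
  linarith [threshold_lt_two]

/-! ## §2 What a refutation costs: `¬r3 → PerfectScreening.NonSaturation` (item 1342, weak `η(3) > 0`) -/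

/-- **IR-saturation along the axis proves r3 with `a = 1`.** [cite: MessagerMiracleSoleJSP1977, main theorem (monotonicity of ⟨σ₀σ_x⟩ under reflections)] -/
theorem crux_of_irSaturation {ε : ℝ} (hε : 0 < ε)
    (hev : ∀ᶠ n : ℕ in atTop, ε ≤ (n : ℝ) * criticalTwoPoint 3 (Pi.single 0 (n : ℤ))) :
    SubPtolemyFloor := by
  obtain ⟨N, hN⟩ := eventually_atTop.1 hev
  set M : ℕ := max N 1 with hM
  refine ⟨1, min ε (criticalTwoPoint 3 (Pi.single 0 (M : ℤ))), one_lt_threshold,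
    lt_min hε (criticalTwoPoint_axis_pos M), fun n hn => ?_⟩
  rw [zsmul_single_zero_one, Real.rpow_neg_one]
  have hn0 : (0 : ℝ) < n := by exact_mod_cast hn
  have hinv : (n : ℝ)⁻¹ ≤ 1 := inv_le_one_of_one_le₀ (by exact_mod_cast hn)
  rcases le_or_gt M n with hle | hlt
  · have h1 : ε ≤ (n : ℝ) * criticalTwoPoint 3 (Pi.single 0 (n : ℤ)) := hN n ((le_max_left _ _).trans hle)
    calc min ε (criticalTwoPoint 3 (Pi.single 0 (M : ℤ))) * (n : ℝ)⁻¹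
        ≤ ε * (n : ℝ)⁻¹ := mul_le_mul_of_nonneg_right (min_le_left _ _) (inv_nonneg.2 hn0.le)
      _ ≤ criticalTwoPoint 3 (Pi.single 0 (n : ℤ)) := by
          rw [← div_eq_mul_inv, div_le_iff₀ hn0, mul_comm]
          exact h1
  · have hmono : criticalTwoPoint 3 (Pi.single 0 (M : ℤ)) ≤ criticalTwoPoint 3 (Pi.single 0 (n : ℤ)) :=
      criticalTwoPoint_axis_antitone hlt.le
    calc min ε (criticalTwoPoint 3 (Pi.single 0 (M : ℤ))) * (n : ℝ)⁻¹
        ≤ criticalTwoPoint 3 (Pi.single 0 (M : ℤ)) * 1 :=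
          mul_le_mul (min_le_right _ _) hinv (inv_nonneg.2 hn0.le) (criticalTwoPoint_axis_pos M).le
      _ ≤ criticalTwoPoint 3 (Pi.single 0 (n : ℤ)) := by rw [mul_one]; exact hmono

/-- **The Coulomb law (antecedent of `PerfectScreening.CoulombImpliesNontrivial`, `η(3) = 0` two-sided with the
IR bound) proves r3 with `a = 1`.** [folklore] -/
theorem crux_of_coulomb
    (hC : ∃ c : ℝ, 0 < c ∧ ∀ x : Site 3, x ≠ 0 → c / ‖x‖ ≤ criticalTwoPoint 3 x) :
    SubPtolemyFloor := by
  obtain ⟨c, hc, h⟩ := hC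
  refine ⟨1, c, one_lt_threshold, hc, fun n hn => ?_⟩
  have h1 := h _ (axis_ne_zero hn)
  rw [Site.norm_eq_supNorm, supNorm_axis] at h1
  rw [Real.rpow_neg_one, ← div_eq_mul_inv]
  exact h1

/-- `PerfectScreening.NonSaturation` (item stmt-CriticalPhenomena-1342) unfolded. [folklore] -/
theorem nonSaturation_iff :
    PerfectScreening.NonSaturation ↔ ∀ ε : ℝ, 0 < ε → ∃ᶠ n : ℕ in atTop,
      (n : ℝ) * criticalTwoPoint 3 (Pi.single 0 (n : ℤ)) < ε :=
  Iff.rfl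

/-- **A refutation of r3 proves item 1342** (weak `η(3) > 0`: the IR bound is not saturated along the
axis) — itself a well-known open problem on `ℤ³` (Duminil-Copin ICM 2022 §4.2). [cite: DuminilCopinICM2022, §4.2.1 p. 12] -/
theorem nonSaturation_of_not_crux (h : ¬ SubPtolemyFloor) : PerfectScreening.NonSaturation := by
  intro ε hε
  by_contra hcon
  rw [Filter.not_frequently] at hcon
  exact h (crux_of_irSaturation hε (hcon.mono fun n hn => not_lt.1 hn))

/-- The dichotomy form: `r3 ∨ NonSaturation` holds unconditionally. [folklore] -/
theorem crux_or_nonSaturation : SubPtolemyFloor ∨ PerfectScreening.NonSaturation :=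
  (em SubPtolemyFloor).imp_right nonSaturation_of_not_crux

/-! ## §3 Conditional characterisation: with an exponent / a scaling limit, r3 is ONE inequality -/

/-- **Abstract core: a power floor bounds the log-exponent.** If `c·n^{-a} ≤ g(n)` for `n ≥ 1` (`c > 0`)
and `log g(n) / log n → -L`, then `L ≤ a`. [folklore] -/
theorem exponent_le_of_floor {g : ℕ → ℝ} {L a c : ℝ} (hc : 0 < c)
    (h : ∀ n : ℕ, 1 ≤ n → c * (n : ℝ) ^ (-a) ≤ g n) (hL : HasDecayExponent g L) : L ≤ a := by
  have hlow : ∀ᶠ n : ℕ in atTop, Real.log c / Real.log n - a ≤ Real.log (g n) / Real.log n := by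
    filter_upwards [eventually_ge_atTop 2] with n hn
    have hn0 : (0 : ℝ) < n := by exact_mod_cast (by omega : 0 < n)
    have hlogn : 0 < Real.log n := Real.log_pos (by exact_mod_cast (by omega : 1 < n))
    have hpow : 0 < (n : ℝ) ^ (-a) := Real.rpow_pos_of_pos hn0 _
    have hgn : c * (n : ℝ) ^ (-a) ≤ g n := h n (by omega)
    have hlog : Real.log c + (-a) * Real.log n ≤ Real.log (g n) := by
      rw [← Real.log_rpow hn0, ← Real.log_mul hc.ne' hpow.ne']
      exact Real.log_le_log (mul_pos hc hpow) hgn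
    have e : Real.log c / Real.log n - a = (Real.log c + (-a) * Real.log n) / Real.log n := by
      field_simp
      ring
    rw [e, div_le_div_iff_of_pos_right hlogn]
    exact hlog
  have hlim : Tendsto (fun n : ℕ => Real.log c / Real.log n - a) atTop (𝓝 (0 - a)) :=
    (tendsto_const_nhds.div_atTop (Real.tendsto_log_atTop.comp tendsto_natCast_atTop_atTop)).sub_const a
  have := le_of_tendsto_of_tendsto hlim hL hlow
  linarith

/-- **If the axial exponent exists, r3 is exactly `L < log₂(1+√2)`.** (`→`: `exponent_le_of_floor`;
`←`: for `L < a < log₂(1+√2)`, `a ≥ 0`, eventually `G(ne₁) ≥ n^{-a}`, and the finitely many small `n` are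
absorbed into `c = G(Ne₁) ≤ 1` by axial monotonicity.) [folklore] -/
theorem crux_iff_of_hasDecayExponent {L : ℝ}
    (hL : HasDecayExponent (fun m : ℕ => criticalTwoPoint 3 (Pi.single 0 (m : ℤ))) L) :
    SubPtolemyFloor ↔ L < Real.logb 2 (1 + Real.sqrt 2) := by
  rw [crux_iff_single]
  constructor
  · rintro ⟨a, c, ha, hc, h⟩
    exact (exponent_le_of_floor hc h hL).trans_lt ha
  · intro hLT
    set T := Real.logb 2 (1 + Real.sqrt 2) with hT
    set a : ℝ := max 0 ((L + T) / 2) with ha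
    have hT1 : 1 < T := one_lt_threshold
    have haT : a < T := max_lt (by linarith) (by linarith)
    have hLa : L < a := lt_of_lt_of_le (by linarith) (le_max_right _ _)
    have ha0 : 0 ≤ a := le_max_left _ _
    have hev : ∀ᶠ n : ℕ in atTop,
        -a < Real.log (criticalTwoPoint 3 (Pi.single 0 (n : ℤ))) / Real.log n :=
      hL.eventually_const_lt (by linarith)
    obtain ⟨N, hN⟩ := eventually_atTop.1 (hev.and (eventually_ge_atTop 2))
    have hge : ∀ n : ℕ, N ≤ n → (n : ℝ) ^ (-a) ≤ criticalTwoPoint 3 (Pi.single 0 (n : ℤ)) := by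
      intro n hn
      obtain ⟨h1, h2⟩ := hN n hn
      have hn0 : (0 : ℝ) < n := by exact_mod_cast (by omega : 0 < n)
      have hlogn : 0 < Real.log n := Real.log_pos (by exact_mod_cast (by omega : 1 < n))
      have hgpos := criticalTwoPoint_axis_pos n
      rw [lt_div_iff₀ hlogn] at h1
      have h3 : Real.log ((n : ℝ) ^ (-a)) < Real.log (criticalTwoPoint 3 (Pi.single 0 (n : ℤ))) := by
        rw [Real.log_rpow hn0]; exact h1
      exact ((Real.log_lt_log_iff (Real.rpow_pos_of_pos hn0 _) hgpos).1 h3).le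
    have hN1 : 1 ≤ N := by have := (hN N le_rfl).2; omega
    refine ⟨a, criticalTwoPoint 3 (Pi.single 0 (N : ℤ)), haT, criticalTwoPoint_axis_pos N,
      fun n hn => ?_⟩
    have hn0 : (0 : ℝ) < n := by exact_mod_cast hn
    have hgN1 : criticalTwoPoint 3 (Pi.single 0 (N : ℤ)) ≤ 1 := criticalTwoPoint_le_one' _
    have hgN0 : 0 ≤ criticalTwoPoint 3 (Pi.single 0 (N : ℤ)) := (criticalTwoPoint_axis_pos N).le
    have hpow1 : (n : ℝ) ^ (-a) ≤ 1 :=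
      Real.rpow_le_one_of_one_le_of_nonpos (by exact_mod_cast hn) (by linarith)
    have hpow0 : 0 ≤ (n : ℝ) ^ (-a) := Real.rpow_nonneg hn0.le _
    rcases le_or_gt N n with hle | hlt
    · calc criticalTwoPoint 3 (Pi.single 0 (N : ℤ)) * (n : ℝ) ^ (-a)
          ≤ 1 * (n : ℝ) ^ (-a) := mul_le_mul_of_nonneg_right hgN1 hpow0
        _ = (n : ℝ) ^ (-a) := one_mul _
        _ ≤ criticalTwoPoint 3 (Pi.single 0 (n : ℤ)) := hge n hle
    · calc criticalTwoPoint 3 (Pi.single 0 (N : ℤ)) * (n : ℝ) ^ (-a)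
          ≤ criticalTwoPoint 3 (Pi.single 0 (N : ℤ)) * 1 := mul_le_mul_of_nonneg_left hpow1 hgN0
        _ = criticalTwoPoint 3 (Pi.single 0 (N : ℤ)) := mul_one _
        _ ≤ criticalTwoPoint 3 (Pi.single 0 (n : ℤ)) := criticalTwoPoint_axis_antitone hlt.le

/-- **Given a non-degenerate pointwise scaling limit whose renormalisation has index `-Δ` (ratio clause at
`c = 1/2`), r3 is exactly `2Δ < log₂(1+√2)`** (`HasPointwiseScalingLimit.hasDecayExponent_axis`: the axial
exponent exists and equals `2Δ`). [cite: MessagerMiracleSoleJSP1977, main theorem (monotonicity of ⟨σ₀σ_x⟩ under reflections)] -/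
theorem crux_iff_of_limit {ρ : ℝ → ℝ} {S : CorrFamily 3} {Δ : ℝ}
    (hρ : ∀ δ ∈ Set.Ioc (0:ℝ) 1, 0 < ρ δ) (hlim : HasPointwiseScalingLimit (criticalCorr 3) ρ S)
    (hnd : IsNondegenerateTwoPoint S)
    (hratio : Tendsto (fun δ => ρ (1/2 * δ) / ρ δ) (𝓝[>] 0) (𝓝 ((1/2:ℝ) ^ (-Δ)))) :
    SubPtolemyFloor ↔ 2 * Δ < Real.logb 2 (1 + Real.sqrt 2) :=
  crux_iff_of_hasDecayExponent (hlim.hasDecayExponent_axis hρ hnd hratio)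

/-- **Given ANY non-degenerate pointwise scaling limit: there is `Δ ∈ [1/2, 3/4]`, the exponent
`η = 2Δ - 1` exists, and r3 ↔ `2Δ < log₂(1+√2)`** (the tree's automatic scale covariance, Lamperti
ratio clause and DCP 2025 Thm 1.5, `exists_rpow_scale_mem_Icc_threeQuarters`). So, granted a limit, the
crux is the single number `Δ < log₂(1+√2)/2 ≈ 0.6358` and a refutation is `Δ ∈ [0.6358, 0.75]`. [cite: DuminilCopinPanis2025LowerBounds, Theorem 1.5] -/
theorem exists_dim_crux_iff_of_limit {ρ : ℝ → ℝ} {S : CorrFamily 3}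
    (hρ : ∀ δ ∈ Set.Ioc (0:ℝ) 1, 0 < ρ δ) (hlim : HasPointwiseScalingLimit (criticalCorr 3) ρ S)
    (hnd : IsNondegenerateTwoPoint S) :
    ∃ Δ ∈ Set.Icc (1/2 : ℝ) (3/4), HasIsingExponentEta 3 (2 * Δ - 1) ∧
      (SubPtolemyFloor ↔ 2 * Δ < Real.logb 2 (1 + Real.sqrt 2)) := by
  obtain ⟨Δ, hΔ, -, hratio, hη⟩ := hlim.exists_rpow_scale_mem_Icc_threeQuarters hρ hnd
  exact ⟨Δ, hΔ, hη, crux_iff_of_limit hρ hlim hnd (hratio (1/2) (by norm_num))⟩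

/-- **The same with the scaling dimension the route carries**: for a non-degenerate pointwise limit that
is `IsScaleCovariant Δ`, r3 ↔ `2Δ < log₂(1+√2)` (the covariance exponent of a non-degenerate family is
unique, read at the reference pair and scale `2`). This is the converse of the route's proved glue
`interlacingForcesU4_two_mul_dim_le_of_axialFloor` (floor ⇒ `2Δ ≤ a`). [folklore] -/
theorem crux_iff_of_scaleCovariant_limit {ρ : ℝ → ℝ} {S : CorrFamily 3} {Δ : ℝ}
    (hρ : ∀ δ ∈ Set.Ioc (0:ℝ) 1, 0 < ρ δ) (hlim : HasPointwiseScalingLimit (criticalCorr 3) ρ S)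
    (hnd : IsNondegenerateTwoPoint S) (hsc : IsScaleCovariant Δ S) :
    SubPtolemyFloor ↔ 2 * Δ < Real.logb 2 (1 + Real.sqrt 2) := by
  obtain ⟨Δ₂, -, hcov₂, hratio⟩ := hlim.exists_rpow_scale_and_ratio (by norm_num) hρ hnd
  have hx₀ := refPair_mem_nonCoincident (d := 3) (by norm_num)
  set x₀ : Fin 2 → EuclideanSpace ℝ (Fin 3) :=
    ![0, EuclideanSpace.single (⟨0, by norm_num⟩ : Fin 3) (1:ℝ)] with hx₀def
  have ha : 0 < S 2 x₀ := hnd _ hx₀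
  have heq : Δ₂ = Δ := by
    have e₁ := hsc 2 2 two_pos x₀
    have e₂ := hcov₂ 2 2 two_pos x₀ hx₀
    rw [e₁] at e₂
    have h := mul_right_cancel₀ ha.ne' e₂
    have hl : 0 < Real.log 2 := Real.log_pos one_lt_two
    have h' := congrArg Real.log h
    rw [Real.log_rpow two_pos, Real.log_rpow two_pos] at h'
    have h'' := mul_right_cancel₀ hl.ne' h'
    push_cast at h''
    linarith
  subst heq
  exact crux_iff_of_limit hρ hlim hnd (hratio (1/2) (by norm_num))

/-- **Under the route's own crux `MoebiusLimit`** (any witness): `Δ ∈ [1/2, 3/4]`, `η = 2Δ-1` exists, and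
r3 ↔ `2Δ < log₂(1+√2)`. Inside the route, r3 is therefore exactly the claim that the (unique) scaling
dimension of the Ising₃ limit is `< 0.6358` (truth `0.5181489(10)`). [cite: KosPolandSimmonsDuffinVichi2016, Table 2 (Δ_σ = 0.5181489(10))] -/
theorem crux_iff_of_moebiusLimit (hML : MoebiusLimit) :
    ∃ Δ ∈ Set.Icc (1/2 : ℝ) (3/4), HasIsingExponentEta 3 (2 * Δ - 1) ∧
      (SubPtolemyFloor ↔ 2 * Δ < Real.logb 2 (1 + Real.sqrt 2)) := by
  obtain ⟨ρ, Δ, S, hρ, -, hlim, hnd, -⟩ := hML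
  exact exists_dim_crux_iff_of_limit hρ hlim hnd

/-- **What a kill IS, given a limit**: `¬r3 ↔ log₂(1+√2) ≤ 2Δ` — with the tree's `2Δ ≤ 3/2` the target
window of a disproof is `2Δ ∈ [1.2716, 1.5]`, i.e. `η(3) ∈ [0.2716, 0.5]`. [folklore] -/
theorem not_crux_iff_of_limit {ρ : ℝ → ℝ} {S : CorrFamily 3} {Δ : ℝ}
    (hρ : ∀ δ ∈ Set.Ioc (0:ℝ) 1, 0 < ρ δ) (hlim : HasPointwiseScalingLimit (criticalCorr 3) ρ S)
    (hnd : IsNondegenerateTwoPoint S) (hsc : IsScaleCovariant Δ S) :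
    ¬ SubPtolemyFloor ↔ Real.logb 2 (1 + Real.sqrt 2) ≤ 2 * Δ := by
  rw [crux_iff_of_scaleCovariant_limit hρ hlim hnd hsc, not_lt]

/-! ## §4 Threshold tightness: the balanced Gaussian test dies exactly at `log₂(1+√2)` -/

/-- `2^{-log₂(1+√2)} = (1+√2)⁻¹ = √2 - 1`. [folklore] -/
theorem rpow_neg_threshold : (2:ℝ) ^ (-(Real.logb 2 (1 + Real.sqrt 2))) = Real.sqrt 2 - 1 := by
  have hpos : 0 < 1 + Real.sqrt 2 := by positivity
  rw [Real.rpow_neg (by norm_num), Real.rpow_logb (by norm_num) (by norm_num) hpos]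
  have hs : Real.sqrt 2 ^ 2 = 2 := Real.sq_sqrt (by norm_num)
  have hkey : (1 + Real.sqrt 2) * (Real.sqrt 2 - 1) = 1 := by nlinarith [hs]
  exact inv_eq_of_mul_eq_one_right hkey

/-- **The sign test.** With `u = 2^{-t}` the route's bound at `x⋆ = (0,2,3,6)e₁` is
`U₄(x⋆) ≤ s₁s₃(1 - 2u - u²)`, and `1 - 2u - u² < 0 ↔ t < log₂(1+√2)`. [folklore] -/
theorem balancedTest_neg_iff {t : ℝ} :
    1 - 2 * (2:ℝ) ^ (-t) - ((2:ℝ) ^ (-t)) ^ 2 < 0 ↔ t < Real.logb 2 (1 + Real.sqrt 2) := by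
  have hu0 : 0 < (2:ℝ) ^ (-t) := Real.rpow_pos_of_pos two_pos _
  have hs : Real.sqrt 2 ^ 2 = 2 := Real.sq_sqrt (by norm_num)
  have hs0 : 0 ≤ Real.sqrt 2 := Real.sqrt_nonneg 2
  have key : 1 - 2 * (2:ℝ) ^ (-t) - ((2:ℝ) ^ (-t)) ^ 2 < 0 ↔ Real.sqrt 2 - 1 < (2:ℝ) ^ (-t) := by
    constructor
    · intro h
      by_contra hle
      rw [not_lt] at hle
      have h3 : 0 ≤ (Real.sqrt 2 - ((2:ℝ) ^ (-t) + 1)) * (Real.sqrt 2 + ((2:ℝ) ^ (-t) + 1)) :=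
        mul_nonneg (by linarith) (by linarith)
      nlinarith [h3, hs, h]
    · intro h
      have h3 : 0 < ((2:ℝ) ^ (-t) + 1 - Real.sqrt 2) * ((2:ℝ) ^ (-t) + 1 + Real.sqrt 2) :=
        mul_pos (by linarith) (by linarith)
      nlinarith [h3, hs]
  rw [key, ← rpow_neg_threshold, Real.rpow_lt_rpow_left_iff one_lt_two]
  constructor <;> intro h <;> linarith

/-- At the threshold the test is exactly zero (Ptolemy's EQUALITY: the planar/Gaussian balance). [folklore] -/
theorem balancedTest_eq_zero_at_threshold :
    1 - 2 * (2:ℝ) ^ (-(Real.logb 2 (1 + Real.sqrt 2))) -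
      ((2:ℝ) ^ (-(Real.logb 2 (1 + Real.sqrt 2)))) ^ 2 = 0 := by
  rw [rpow_neg_threshold]
  have hs : Real.sqrt 2 ^ 2 = 2 := Real.sq_sqrt (by norm_num)
  linear_combination (-1 : ℝ) * hs

/-- **Tightness of the crux's constant**: for `t ≥ log₂(1+√2)` the test is `≥ 0` — relaxing `a < log₂(1+√2)`
to `a ≤ log₂(1+√2)` or to any larger threshold admits exponents at which the route's mechanism
(`InterlacingForcesU4`) yields no sign for `U₄(x⋆)`. [folklore] -/
theorem balancedTest_nonneg_of_threshold_le {t : ℝ} (ht : Real.logb 2 (1 + Real.sqrt 2) ≤ t) :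
    0 ≤ 1 - 2 * (2:ℝ) ^ (-t) - ((2:ℝ) ^ (-t)) ^ 2 :=
  not_lt.1 fun h => (not_lt.2 ht) (balancedTest_neg_iff.1 h)

/-! ## §5 Two-point axiomatics do not decide r3: the profile `n^{-3/2}` -/

/-- The model profile `p(n) = n^{-3/2}` has log-exponent `3/2`. [folklore] -/
theorem modelProfile_hasDecayExponent :
    HasDecayExponent (fun n : ℕ => (n : ℝ) ^ (-(3/2 : ℝ))) (3/2) := by
  unfold HasDecayExponent
  refine (tendsto_const_nhds (x := (-(3/2 : ℝ)))).congr' ?_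
  filter_upwards [eventually_ge_atTop 2] with n hn
  have hn0 : (0 : ℝ) < n := by exact_mod_cast (by omega : 0 < n)
  have hlogn : Real.log n ≠ 0 := (Real.log_pos (by exact_mod_cast (by omega : 1 < n))).ne'
  rw [Real.log_rpow hn0, mul_div_assoc, div_self hlogn, mul_one]

/-- The model profile lies in the rigorous two-point window `n^{-2} ≤ p(n) ≤ n^{-1}` (Simon–Lieb / IR shape)
and is monotone. [folklore] -/
theorem modelProfile_window {n : ℕ} (hn : 1 ≤ n) :
    (n : ℝ) ^ (-(2 : ℝ)) ≤ (n : ℝ) ^ (-(3/2 : ℝ)) ∧ (n : ℝ) ^ (-(3/2 : ℝ)) ≤ (n : ℝ) ^ (-(1 : ℝ)) := by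
  have h1 : (1 : ℝ) ≤ n := by exact_mod_cast hn
  exact ⟨Real.rpow_le_rpow_of_exponent_le h1 (by norm_num),
    Real.rpow_le_rpow_of_exponent_le h1 (by norm_num)⟩

/-- The model profile is antitone on `n ≥ 1`. [folklore] -/
theorem modelProfile_anti {m n : ℕ} (hm : 1 ≤ m) (hmn : m ≤ n) :
    (n : ℝ) ^ (-(3/2 : ℝ)) ≤ (m : ℝ) ^ (-(3/2 : ℝ)) :=
  Real.rpow_le_rpow_of_nonpos (by exact_mod_cast hm) (by exact_mod_cast hmn) (by norm_num)

/-- **The model profile violates the floor**: no `a < log₂(1+√2)`, `c > 0` with `c·n^{-a} ≤ n^{-3/2}` for all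
`n ≥ 1` (`exponent_le_of_floor` and `log₂(1+√2) < 3/2`). Hence the axial consequences of the tree's
two-point knowledge at `β_c(3)` — window, monotonicity, the DCP `3/2`-bound — cannot prove r3. [folklore] -/
theorem not_floor_modelProfile :
    ¬ ∃ a c : ℝ, a < Real.logb 2 (1 + Real.sqrt 2) ∧ 0 < c ∧ ∀ n : ℕ, 1 ≤ n →
        c * (n : ℝ) ^ (-a) ≤ (n : ℝ) ^ (-(3/2 : ℝ)) := by
  rintro ⟨a, c, ha, hc, h⟩
  have hL := exponent_le_of_floor hc h modelProfile_hasDecayExponent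
  linarith [threshold_lt_three_halves]

/-! ## §6 Targets

No line has been picked for this crux yet (`PICKED.md` absent, payload `stuck_stubs = []`); the two
round-1 ideas (`volume-threshold-split`, `lee-yang-tail-transfer`) file first lemmas that are
bookkeeping over tree theorems — their open inputs (`AxisDoubling κ>1/8`, `SusceptibilityFloor`,
`BlockTailFloor`) inherit §3: granted a limit each is equivalent to / implies `2Δ < log₂(1+√2)` and is
refutable only by `Δ ≥ 0.6358`. -/

end Summit.CriticalPhenomena.Ising3DConformalLimit.Cruxes.SubPtolemyFloor.Disproof

end
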